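import Summits.QuantumFields.YangMills.Theorems.AlphaInputsT3ACv3OfDataSchema
import HarnessLib

/-!
# `AlphaInputsT3ACv3DataSchemaRec` — STRATEGY B for 2′: the RECORD-PARAMETRIC displayed schema `DataSchemaT3ACRec L` (the quantifier shell of the
# registered 2′ text `AlphaInputsT3ACv3Rec L` VERBATIM, with `OfV3At ↦ DataSchemaT3AC`) and the corollary `DataSchemaT3ACRec L → AlphaInputsT3ACv3Rec L`
# (design note `STRATEGY-B-adapted-class-T3-alpha1-g5.md` §B.0, second line) — lane `pub-balaban3d`, seat alpha-2 (g0)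

WHAT.  `AlphaInputsT3ACv3Rec L` (the type of 2′ `stub_laneRecordsV3`, items 19935∕19936) is `∃ b₁ p₁ ∀ b₀ p₀ ⪰ ∃ 𝔠 a₀ a₁, 𝔠.b₀ = b₀ ∧ 𝔠.p₀ = p₀ ∧ … ∧
∀ F, OfV3At F 𝔠 a₀ a₁`; by `AlphaInputsT3AC.ofV3At_of_dataSchemaT3` (sibling `AlphaInputsT3ACv3OfDataSchema`) it follows from the SAME shell over the displayed
data schema.  HONEST FRAMING: the ∃-clause over the primitive-constants record `𝔠` (exact p-profile, the window inequality (N1) inside `DataSchemaT3AC`) stays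
DISPLAYED in `DataSchemaT3ACRec` — the EXHIBITION of `𝔠` from a profile `(b₀, p₀)` (design note §B.4: `r₀ := (p₀−1)/2`, `cJ35` solving the `b₀`-equation,
`C68` bumped for (N1)) is NOT done here.  2′ is thereby re-cut to «displayed DATA + [7] Thm 1 + non-emptiness + constants bookkeeping»; nothing of the cluster
expansion is proved; nothing about d = 4, the continuum, or a mass gap.

References: T. Bałaban, Commun. Math. Phys. 102 (1985) 255–275 [Balaban1985UV3] ((7) p.257, Thm 2 p.272); CMP 102 (1985) 277–309 [Balaban1985Variational]
(Thm 1 (8) p.279).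
-/

set_option autoImplicit false

noncomputable section

namespace Summit.QuantumFields.YangMills.Theorems

open Literature.MathematicalPhysics.QuantumFieldTheory.Balaban1983to89
open Literature.MathematicalPhysics.QuantumFieldTheory.Balaban1983to89.T3ContinuumYM3Torus
open Literature.MathematicalPhysics.QuantumFieldTheory.Balaban1985CMP102.Setting
open Summit.QuantumFields.Balaban3D.Carriers
open Summit.QuantumFields.Balaban3D.Proofs.Primitives

/-- **`DataSchemaT3ACRec L` — THE RECORD-PARAMETRIC DISPLAYED DATA SCHEMA** (hypothesis schema, OPEN, never asserted): `AlphaInputsT3ACv3Rec L`'s text with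
`AlphaInputsT3AC.OfV3At ↦ DataSchemaT3AC` — thresholds `b₁, p₁` such that for every profile `(b₀, p₀)` beyond them there is a primitive-constants record `𝔠`
with EXACTLY that p-function and [Balaban1985Variational] constants `a₀, a₁` (`0 < a₀`, `0 < a₁`, `B₃a₁ ≤ a₀`) such that the displayed data schema of strategy B
holds for every three-torus family of block size `L`. [cite: Balaban1985UV3, (7) p.257 and Thm 2 p.272; Balaban1985Variational, Thm 1 (8) p.279] -/
def DataSchemaT3ACRec (L : ℕ) : Prop :=
  ∃ (b₁ p₁ : ℝ), ∀ (b₀ p₀ : ℝ), b₁ ≤ b₀ → p₁ ≤ p₀ →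
    ∃ (𝔠 : AlphaConsts L (suGroupModel 2).N) (a₀ a₁ : ℝ), 𝔠.b₀ = b₀ ∧ 𝔠.p₀ = p₀ ∧ 0 < a₀ ∧ 0 < a₁ ∧ 𝔠.B₃ * a₁ ≤ a₀ ∧
      ∀ (F : T3Family) (hF : F.L = L), DataSchemaT3AC F (hF ▸ 𝔠) a₀ a₁

/-- **★ 2′ FROM THE RECORD-PARAMETRIC DATA SCHEMA**: `DataSchemaT3ACRec L → AlphaInputsT3ACv3Rec L` — the registered 2′ text re-cut to the displayed data
(same quantifier shell; `ofV3At_of_dataSchemaT3` inside). [cite: Balaban1985UV3, Thm 2 p.272; Balaban1985Variational, Thm 1 (8) p.279] -/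
theorem alphaInputsT3ACv3Rec_of_dataSchemaRec {L : ℕ} (h : DataSchemaT3ACRec L) : AlphaInputsT3ACv3Rec L := by
  obtain ⟨b₁, p₁, h⟩ := h
  refine ⟨b₁, p₁, fun b₀ p₀ hb hp => ?_⟩
  obtain ⟨𝔠, a₀, a₁, h1, h2, h3, h4, h5, hD⟩ := h b₀ p₀ hb hp
  exact ⟨𝔠, a₀, a₁, h1, h2, h3, h4, h5, fun F hF => AlphaInputsT3AC.ofV3At_of_dataSchemaT3 (hD F hF)⟩

end Summit.QuantumFields.YangMills.Theorems

end
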